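import Summits.QuantumAdvantage.QuantumAdvantage.Theorems.CubicForrelationSignedExactCubicForrelationNotPrBPPStubKernelStatsRadical
import Summits.QuantumAdvantage.QuantumAdvantage.Theorems.CubicForrelationSignedExactCubicForrelationNotPrBPPStubFrameLock

/-!
# Crux `CubicForrelation.SignedExactCubicForrelationNotPrBPP` (stmt-QuantumAdvantage-13932), line `dual-pingpong-frame`
# (GROW reshape c3): stub `stub_kernelStatsRadicalA` — kernel statistics at `a`-side radical-visible pairs

Support file (`--supports stmt-QuantumAdvantage-13932`). The registered stub `stub_kernelStatsRadicalA` is the mirror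
image of the landed `stub_kernelStatsRadical` (module `…StubKernelStatsRadical`) on the swapped pair: roles
`(b, S, U) ↦ (a, U, S)` with `a = (C 0).eval`, `b = (C 1).eval`, and `r = m + m + 1` probes. If some radical direction `v`
of `a` lies in `Z_a(U) ∩ S^⊥ ∖ U`, the `a`-side disjunct of `Grow.KernelStats` holds:

* the only new ingredient is the M-subspace of `a` through `U` orthogonal to `S`: the dual frame
  `W = V^⊥ = {y : (-1)^{v·y} = 1 ∀ v ∈ V}` of the no-trap extension `V ⊇ S`, `V ⊥ U` of the pair (landed
  `stub_noTrapTransport stub_noTrapTemplate`), which is an M-subspace of `a` by the landed two-tensor frame lock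
  `stub_frameLock` (i); `U ⊆ W` because `V ⊥ U`, `W ⊥ S` because `S ⊆ V` (`dualFrame_sub_and_orth`, bridge
  `PolarGeometry.twist_eq_one_iff_bdot`), and `|W| = 2^m > |U|` from `|W|² = 2ⁿ`;
* everything else is the `b`-side argument verbatim for the Boolean function `a` (the helper lemmas of
  `KernelStatsRadical` are stated for an arbitrary Boolean function): spanning probes see the radical
  (`radical_of_probes`), candidates outside `U` are good (third brick with `W`), the candidate space is stable under
  `· ⊕ v` so its good density is `≥ 1/2` (`half_le_card_filter_div_card`), and spanning tuples are the majority
  (first brick), whence the sum is `≥ 2^{n(n+1)}/4 ≥ 2^{n(n+1)}/(n+2)^8` (`quarter_card_le_sum`).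

No definitions.

References: C. Carlet, *Boolean Functions for Cryptography and Coding Theory*, CUP 2021, Prop. 54 (M-subspaces), Prop. 77
(duals of Maiorana–McFarland functions) [Carlet2020]; S. Arora, B. Barak, *Computational Complexity: A Modern Approach*,
CUP 2009, §7.1 [AroraBarak2009]. -/

noncomputable section

set_option linter.dupNamespace false -- D-0017: single-problem summit ⇒ `QuantumAdvantage.QuantumAdvantage` by design

namespace Summit.QuantumAdvantage.QuantumAdvantage.Theorems.SignedExactCubicForrelationNotPrBPP

open Finset
open Literature.Computability.Complexity Literature.Computability.QuantumComplexity
open Literature.Computability.QuantumComplexity.BuzetChailloux (bxor zeroVec)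

namespace KernelStatsRadicalA

/-- **The dual frame passes through `U` and is orthogonal to `S`.** If `S ⊆ V` and `V ⊥ U`, then the dual frame
`W = V^⊥ = {y : (-1)^{v·y} = 1 ∀ v ∈ V}` contains `U` and is orthogonal to `S` (inner products as parities, bridge
`twist s u = 1 ↔ s·u = 0`). [folklore] -/
theorem dualFrame_sub_and_orth {n : ℕ} (S U V : Finset (Fin n → Bool)) (hSV : S ⊆ V)
    (hVU : ∀ s ∈ V, ∀ u ∈ U, ((Finset.univ.filter fun i => s i && u i).card).bodd = false) :
    U ⊆ (Finset.univ.filter fun y : Fin n → Bool => ∀ v ∈ V, twist v y = 1) ∧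
      ∀ s ∈ (Finset.univ.filter fun y : Fin n → Bool => ∀ v ∈ V, twist v y = 1), ∀ u ∈ S,
        ((Finset.univ.filter fun i => s i && u i).card).bodd = false := by
  refine ⟨fun u hu => Finset.mem_filter.2 ⟨Finset.mem_univ _, fun v hv =>
    (PolarGeometry.twist_eq_one_iff_bdot v u).2 (hVU v hv u hu)⟩, fun s hs u hu => ?_⟩
  exact (PolarGeometry.bdot_comm s u).trans
    ((PolarGeometry.twist_eq_one_iff_bdot u s).1 ((Finset.mem_filter.1 hs).2 u (hSV hu)))

end KernelStatsRadicalA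

open KernelStatsRadical KernelStatsRadicalA in
/-- **Kernel statistics at `a`-side radical-visible pairs (`r = n + 1` probes).** Registered stub
`stub_kernelStatsRadicalA` of line `dual-pingpong-frame`: the mirror image of `stub_kernelStatsRadical` on the swapped
pair `(a, U, S)`. Given the three bricks, if some radical direction `v` of `a = C 0` lies in `Z_a(U) ∩ S^⊥ ∖ U`, the
`a`-side disjunct of `Grow.KernelStats` holds with `r = m + m + 1`; the no-trap M-subspace of `a` through `U`
orthogonal to `S` is the dual frame `V^⊥` of the `b`-side no-trap extension (`stub_frameLock` (i) on the exact pair),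
of size `2^m > |U|`. [cite: Carlet2020, Prop. 54; AroraBarak2009, §7.1] -/
theorem stub_kernelStatsRadicalA :
    (∀ n : ℕ, 2 * (Finset.univ.filter fun xs : Fin (n + 1) → (Fin n → Bool) =>
        ∃ w : Fin n → Bool, w ≠ zeroVec ∧ ∀ j, ((Finset.univ.filter fun i => w i && xs j i).card).bodd = false).card
      ≤ 2 ^ (n * (n + 1))) →
    (∀ (n r : ℕ) (xs : Fin r → (Fin n → Bool)),
      (∀ w : Fin n → Bool, (∀ j, ((Finset.univ.filter fun i => w i && xs j i).card).bodd = false) → w = zeroVec) →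
      ∀ W : Finset (Fin n → Bool), zeroVec ∈ W → (∀ x ∈ W, ∀ y ∈ W, bxor x y ∈ W) → (∀ j, xs j ∈ W) → W = Finset.univ) →
    (∀ (n : ℕ) (b : (Fin n → Bool) → Bool) (S U V : Finset (Fin n → Bool)) (v : Fin n → Bool),
      (zeroVec ∈ S ∧ ∀ x ∈ S, ∀ y ∈ S, bxor x y ∈ S) →
      ((zeroVec ∈ V ∧ ∀ x ∈ V, ∀ y ∈ V, bxor x y ∈ V) ∧ (((V).card : ℝ) ^ 2 = (2 : ℝ) ^ n) ∧
        ∀ u ∈ V, ∀ w ∈ V, ∀ x, (b x ^^ b (bxor x u) ^^ b (bxor x w) ^^ b (bxor x (bxor u w))) = false) →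
      S ⊆ V → (∀ s ∈ V, ∀ u ∈ U, ((Finset.univ.filter fun i => s i && u i).card).bodd = false) → S.card < V.card →
      (∀ x y z : Fin n → Bool, ((b z ^^ b (bxor z x) ^^ b (bxor z v) ^^ b (bxor z (bxor x v))) ^^
          (b (bxor z y) ^^ b (bxor (bxor z y) x) ^^ b (bxor (bxor z y) v) ^^ b (bxor (bxor z y) (bxor x v)))) = false) →
      (∀ s ∈ S, ∀ x, (b x ^^ b (bxor x s) ^^ b (bxor x v) ^^ b (bxor x (bxor s v))) = false) →
      (∀ u ∈ U, ((Finset.univ.filter fun i => u i && v i).card).bodd = false) →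
      ∃ V' : Finset (Fin n → Bool), ((zeroVec ∈ V' ∧ ∀ x ∈ V', ∀ y ∈ V', bxor x y ∈ V') ∧ (((V').card : ℝ) ^ 2 = (2 : ℝ) ^ n) ∧
          ∀ u ∈ V', ∀ w ∈ V', ∀ x, (b x ^^ b (bxor x u) ^^ b (bxor x w) ^^ b (bxor x (bxor u w))) = false) ∧
        S ⊆ V' ∧ v ∈ V' ∧ (∀ s ∈ V', ∀ u ∈ U, ((Finset.univ.filter fun i => s i && u i).card).bodd = false)) →
    ∀ (m : ℕ) (C : Fin 2 → Circuit (Fin (m + m))),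
        (⟨m + m, 2, C⟩ : KForrelationInstance).IsOverB2 →
        (∀ i, IsDegLeFun 3 (C i).eval) →
        (forrelation (C 0).eval (C 1).eval = 1 ∨ forrelation (C 0).eval (C 1).eval = -1) →
        (∃ e : (Fin (m + m) → Bool) ≃ (Fin (m + m) → Bool),
          (∃ M : Matrix (Fin (m + m)) (Fin (m + m)) (ZMod 2), ∃ c : Fin (m + m) → ZMod 2,
            ∀ y i, (if e y i then (1 : ZMod 2) else 0) = (M.mulVec (fun j => if y j then (1 : ZMod 2) else 0) + c) i) ∧
          ∃ perm : (Fin m → Bool) ≃ (Fin m → Bool), ∃ h : (Fin m → Bool) → Bool, ∀ y' y'' : Fin m → Bool,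
            (if (C 1).eval (e (Fin.append y' y'')) then (1 : ZMod 2) else 0) =
              (∑ i, (if y' i then (1 : ZMod 2) else 0) * (if perm y'' i then (1 : ZMod 2) else 0)) +
                (if h y'' then (1 : ZMod 2) else 0)) →
        ∀ S U : Finset (Fin (m + m) → Bool),
          (zeroVec ∈ S ∧ ∀ x ∈ S, ∀ y ∈ S, bxor x y ∈ S) → (zeroVec ∈ U ∧ ∀ x ∈ U, ∀ y ∈ U, bxor x y ∈ U) →
          ((∀ s ∈ S, ∀ y : Fin (m + m) → Bool, (fun k => ((C 1).eval zeroVec ^^ (C 1).eval (bxor zeroVec s) ^^ (C 1).eval (bxor zeroVec y) ^^ (C 1).eval (bxor zeroVec (bxor s y))) ^^ ((C 1).eval (fun j => decide (j = k)) ^^ (C 1).eval (bxor (fun j => decide (j = k)) s) ^^ (C 1).eval (bxor (fun j => decide (j = k)) y) ^^ (C 1).eval (bxor (fun j => decide (j = k)) (bxor s y)))) ∈ U) ∧ (∀ s ∈ S, ∃ ℓ ∈ U, ∀ r : Fin (m + m) → Bool, (∀ y z : Fin (m + m) → Bool, (((C 1).eval z ^^ (C 1).eval (bxor z s) ^^ (C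 1).eval (bxor z r) ^^ (C 1).eval (bxor z (bxor s r))) ^^ ((C 1).eval (bxor z y) ^^ (C 1).eval (bxor (bxor z y) s) ^^ (C 1).eval (bxor (bxor z y) r) ^^ (C 1).eval (bxor (bxor z y) (bxor s r)))) = false) → ((C 1).eval r ^^ (C 1).eval (bxor r s) ^^ (C 1).eval zeroVec ^^ (C 1).eval s) = ((Finset.univ.filter fun i => ℓ i && r i).card).bodd)) →
          ((∀ s ∈ U, ∀ y : Fin (m + m) → Bool, (fun k => ((C 0).eval zeroVec ^^ (C 0).eval (bxor zeroVec s) ^^ (C 0).eval (bxor zeroVec y) ^^ (C 0).eval (bxor zeroVec (bxor s y))) ^^ ((C 0).eval (fun j => decide (j = k)) ^^ (C 0).eval (bxor (fun j => decide (j = k)) s) ^^ (C 0).eval (bxor (fun j => decide (j = k)) y) ^^ (C 0).eval (bxor (fun j => decide (j = k)) (bxor s y)))) ∈ S) ∧ (∀ s ∈ U, ∃ ℓ ∈ S, ∀ r : Fin (m + m) → Bool, (∀ y z : Fin (m + m) → Bool, (((C 0).eval z ^^ (C 0).eval (bxor z s) ^^ (C 0).eval (bxor z r) ^^ (C 0).eval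 (bxor z (bxor s r))) ^^ ((C 0).eval (bxor z y) ^^ (C 0).eval (bxor (bxor z y) s) ^^ (C 0).eval (bxor (bxor z y) r) ^^ (C 0).eval (bxor (bxor z y) (bxor s r)))) = false) → ((C 0).eval r ^^ (C 0).eval (bxor r s) ^^ (C 0).eval zeroVec ^^ (C 0).eval s) = ((Finset.univ.filter fun i => ℓ i && r i).card).bodd)) →
          (∀ s ∈ S, ∀ u ∈ U, ((Finset.univ.filter fun i => s i && u i).card).bodd = false) →
          S.card < 2 ^ m → U.card < 2 ^ m →
          (∃ v : Fin (m + m) → Bool, (∀ x y z : Fin (m + m) → Bool, (((C 0).eval z ^^ (C 0).eval (bxor z x) ^^ (C 0).eval (bxor z v) ^^ (C 0).eval (bxor z (bxor x v))) ^^ ((C 0).eval (bxor z y) ^^ (C 0).eval (bxor (bxor z y) x) ^^ (C 0).eval (bxor (bxor z y) v) ^^ (C 0).eval (bxor (bxor z y) (bxor x v)))) = false) ∧ (∀ s ∈ U, ∀ x, ((C 0).eval x ^^ (C 0).eval (bxor x s) ^^ (C 0).eval (bxor x v) ^^ (C 0).eval (bxor x (bxor s v))) = false) ∧ (∀ u ∈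 S, ((Finset.univ.filter fun i => u i && v i).card).bodd = false) ∧ v ∉ U) →
          (∃ r : ℕ, r ≤ m + m + 1 ∧ (2 : ℝ) ^ ((m + m) * r) / ((m + m + 2 : ℝ) ^ 8) ≤ (∑ xs : Fin (r) → (Fin (m + m) → Bool), (((@Finset.filter (Fin (m + m) → Bool) (fun v => v ∉ U ∧ (∃ V : Finset (Fin (m + m) → Bool), ((zeroVec ∈ V ∧ ∀ x ∈ V, ∀ y ∈ V, bxor x y ∈ V) ∧ (((V).card : ℝ) ^ 2 = (2 : ℝ) ^ (m + m)) ∧ ∀ u ∈ V, ∀ v ∈ V, ∀ x, ((C 0).eval x ^^ (C 0).eval (bxor x u) ^^ (C 0).eval (bxor x v) ^^ (C 0).eval (bxor x (bxor u v))) = false) ∧ U ⊆ V ∧ v ∈ V ∧ (∀ s ∈ V, ∀ u ∈ S, ((Finset.univ.filter fun i => s i && u i).card).bodd = false))) (Classical.decPred _) (Finset.univ.filter fun (v : Fin (m + m) → Bool) => (∀ s ∈ U, ∀ x, ((C 0).eval x ^^ (C 0).eval (bxor x s) ^^ (C 0).eval (bxor x v) ^^ (C 0).eval (bxor x (bxor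 s v))) = false) ∧ (∀ u ∈ S, ((Finset.univ.filter fun i => u i && v i).card).bodd = false) ∧ ∀ j, (∀ y z : Fin (m + m) → Bool, (((C 0).eval z ^^ (C 0).eval (bxor z (xs j)) ^^ (C 0).eval (bxor z v) ^^ (C 0).eval (bxor z (bxor (xs j) v))) ^^ ((C 0).eval (bxor z y) ^^ (C 0).eval (bxor (bxor z y) (xs j)) ^^ (C 0).eval (bxor (bxor z y) v) ^^ (C 0).eval (bxor (bxor z y) (bxor (xs j) v)))) = false))).card : ℝ) / (((Finset.univ.filter fun (v : Fin (m + m) → Bool) => (∀ s ∈ U, ∀ x, ((C 0).eval x ^^ (C 0).eval (bxor x s) ^^ (C 0).eval (bxor x v) ^^ (C 0).eval (bxor x (bxor s v))) = false) ∧ (∀ u ∈ S, ((Finset.univ.filter fun i => u i && v i).card).bodd = false) ∧ ∀ j, (∀ y z : Fin (m + m) → Bool, (((C 0).eval z ^^ (C 0).eval (bxor z (xs j)) ^^ (C 0).eval (bxor z v) ^^ (C 0).eval (bxor z (bxor (xs j) v))) ^^ ((C 0).eval (bxor z y) ^^ (C 0).eval (bxor (bxor z y) (xs j)) ^^ (C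 0).eval (bxor (bxor z y) v) ^^ (C 0).eval (bxor (bxor z y) (bxor (xs j) v)))) = false))).card : ℝ)))) := by
  intro h1 h2 h3 m C _hB hdeg hΦ horb S U hS hU hcb hca ho _hSlt hUlt hrad
  obtain ⟨v₀, hv₀R, hv₀Z, hv₀P, hv₀U⟩ := hrad
  -- the no-trap extension `V ⊇ S`, `V ⊥ U` of the pair (an M-subspace of `b`)
  obtain ⟨V, hV, hSV, hVU⟩ :=
    stub_noTrapTransport stub_noTrapTemplate m (C 0).eval (C 1).eval (hdeg 0) (hdeg 1) hΦ horb S U hS hU hcb hca ho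
  -- its dual frame `W = V^⊥` is an M-subspace of `a` (frame lock), through `U`, orthogonal to `S`, of size `2^m`
  obtain ⟨hWM, -, -⟩ := stub_frameLock (m + m) (C 0).eval (C 1).eval V hΦ hV
  obtain ⟨hUW, hWS⟩ := dualFrame_sub_and_orth S U V hSV hVU
  have hcard := hWM.2.1
  have hWc : (Finset.univ.filter fun y : Fin (m + m) → Bool => ∀ v ∈ V, twist v y = 1).card = 2 ^ m := by
    have h2 : (2 : ℝ) ^ (m + m) = ((2 : ℝ) ^ m) ^ 2 := by rw [← pow_mul]; ring_nf
    rw [h2] at hcard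
    have hn : (0 : ℝ) ≤ (Finset.univ.filter fun y : Fin (m + m) → Bool => ∀ v ∈ V, twist v y = 1).card := by
      positivity
    have hp : (0 : ℝ) ≤ (2 : ℝ) ^ m := by positivity
    have := (pow_left_inj₀ hn hp two_ne_zero).1 hcard
    exact_mod_cast this
  have hUWlt : U.card < (Finset.univ.filter fun y : Fin (m + m) → Bool => ∀ v ∈ V, twist v y = 1).card := by
    rw [hWc]; exact hUlt
  refine ⟨m + m + 1, le_rfl, ?_⟩
  -- counting the tuples of probes
  have hcardα : Fintype.card (Fin (m + m + 1) → (Fin (m + m) → Bool)) = 2 ^ ((m + m) * (m + m + 1)) := by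
    rw [Fintype.card_fun, Fintype.card_fun, Fintype.card_bool, Fintype.card_fin, Fintype.card_fin, ← pow_mul]
  have hP : 2 * (Finset.univ.filter fun xs : Fin (m + m + 1) → (Fin (m + m) → Bool) =>
      ∃ w : Fin (m + m) → Bool, w ≠ zeroVec ∧
        ∀ j, ((Finset.univ.filter fun i => w i && xs j i).card).bodd = false).card ≤
      Fintype.card (Fin (m + m + 1) → (Fin (m + m) → Bool)) := by
    rw [hcardα]; exact h1 (m + m)
  refine le_trans ?_ (quarter_card_le_sum ?_ ?_ hP)
  · -- `2^{n(n+1)} / (n+2)^8 ≤ 2^{n(n+1)} / 4`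
    rw [hcardα]
    push_cast
    refine div_le_div_of_nonneg_left (by positivity) (by norm_num) ?_
    have hm : (2 : ℝ) ≤ (m : ℝ) + m + 2 := by linarith [(Nat.cast_nonneg m : (0 : ℝ) ≤ m)]
    calc (4 : ℝ) ≤ 2 ^ 8 := by norm_num
      _ ≤ ((m : ℝ) + m + 2) ^ 8 := pow_le_pow_left₀ (by norm_num) hm 8
  · -- every summand is `≥ 0`
    intro xs
    exact div_nonneg (Nat.cast_nonneg _) (Nat.cast_nonneg _)
  · -- spanning tuples: density `≥ 1/2`
    intro xs hxs
    have hdual : ∀ w : Fin (m + m) → Bool,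
        (∀ j, ((Finset.univ.filter fun i => w i && xs j i).card).bodd = false) → w = zeroVec := by
      intro w hw
      by_contra hne
      exact hxs ⟨w, hne, hw⟩
    have hspan := h2 (m + m) (m + m + 1) xs hdual
    refine half_le_card_filter_div_card _ _ _ U v₀ ?_ hv₀U hU.2 ?_ ?_
    · -- the radical witness is a candidate
      exact Finset.mem_filter.2 ⟨Finset.mem_univ _, hv₀Z, hv₀P, fun j => hv₀R (xs j)⟩
    · -- the candidate space is stable under `· ⊕ v₀`
      intro u hu
      have hu' := (Finset.mem_filter.1 hu).2
      exact Finset.mem_filter.2 ⟨Finset.mem_univ _, zs_bxor (C 0).eval U u v₀ hu'.1 hv₀Z,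
        pu_bxor S u v₀ hu'.2.1 hv₀P, fun j => rc_bxor_right (C 0).eval (xs j) u v₀ (hu'.2.2 j) (hv₀R (xs j))⟩
    · -- every candidate outside `U` is good
      intro u hu huU
      have hu' := (Finset.mem_filter.1 hu).2
      have hradu := radical_of_probes (C 0).eval xs u hspan hu'.2.2
      obtain ⟨V', hV', hUV', huV', hV'S⟩ :=
        h3 (m + m) (C 0).eval U S _ u hU hWM hUW hWS hUWlt hradu hu'.1 hu'.2.1
      exact ⟨huU, V', hV', hUV', huV', hV'S⟩

end Summit.QuantumAdvantage.QuantumAdvantage.Theorems.SignedExactCubicForrelationNotPrBPP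

end
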